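import Summits.ResolutionOfSingularities.ResolutionOfSingularities.Theorems.PurelyInseparableDim4ResConeTransport
import HarnessLib
import HarnessLib.Audit.Tags

/-!
# Purely inseparable four-folds — the TAME CONE AT A CONSTANT-`d` STEP, II: the `x_j`-free layer of the
# new residual cone is a non-zero multiple of the sheared old one (idea-4 I-4-6 (VT)(ii)), and the
# transport of polar-kernel vectors off `e_j` (the input of (VT)(iii))

[OURS · counted 0 · cell `res-dim4-pi` · desk WORD #55 (a) / crit-4 g2 V-A4-13 (FILES 2–3 GO, price
P-A4-13a) · seat res-dim4-p-12 g2.]  Nothing here proves K2(p), `NoIsolatedTrap p p` or resolution of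
singularities in dimension ≥ 4 / characteristic `p`.

Setting (`…ResCone`, `…ResConeChart`, `…ResConeNear`, `…ResConeTransport`): a presented state
`s = (F, r, exc)` with `x^r ∣ F`, `ord₀ F = o` in the band `q < o < 2q`, residual cone `g = resForm s`
(homogeneous of degree `d = o − |r|` = the shade), polar kernel `resVertex s = additiveSubspace g`
(the POLAR KERNEL: it contains the directrix/vertex `Dir V(g)` and equals it for `d < p`; [CJS 2020] Thm. 3.14
is about `V(g)`).  Point step at the chart point `b` of the `x_j`-chart (`b_j = 0`), new state `s′`.

Main results (namespace `…PIDim4.ResCone`):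
* `coeff_topMonomial_ne_zero`, `coeff_topMonomial_add_mul` — the top `x_j`-power of `shear j b x^r` has a
  non-zero coefficient `c`, and multiplying by an `x_j`-free `Q` reads coefficients off layer by layer;
* `step_r_univ` — the new boundary `r′ = (r|_{b = 0}).update j (o − q)`; `ordZero_step_of_shade_eq` — at a
  shade-keeping step `ord₀ F′ = |r′| + d`;
* **`coeff_resForm_step_of_apply_eq_zero`** ((VT)(ii), layer `0`): if the step keeps the shade then for every
  `x_j`-free exponent `ν`, `coeff_ν (resForm s′) = c · coeff_ν (shear j b (resForm s))`
  ([CJS 2020] Thm. 3.10(4) + Thm. 9.3 in frame form: the `u`-free part of the new cone is the old cone read in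
  the sheared coordinates);
* `killVar_resForm_step` — `(resForm s′)|_{x_j = 0} = c • shear j b (resForm s)`;
* **`mem_additiveSubspace_shear_of_mem_resVertex_step`** — a vector `w` of the new polar kernel with
  `w_j = 0` lies in the polar kernel of the sheared old cone (the injection behind (VT)(iii)).
bears_on: LADDER-RESOLUTION:D157-DOOR2 (res-dim4-pi · K2(p) · I-4-6 (VT)(ii)/(iii)).  Supports
stmt-ResolutionOfSingularities-16155 (helper).
-/

set_option linter.dupNamespace false -- mandated namespace of this single-conjunct summit

noncomputable section

namespace Summit.ResolutionOfSingularities.ResolutionOfSingularities.Theorems.PIDim4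

namespace ResCone

open MvPolynomial Finset
open Literature.AlgebraicGeometry.Resolution
open Literature.AlgebraicGeometry.Resolution.CentreBlowup
open Literature.AlgebraicGeometry.Resolution.Hauser2010
open Literature.AlgebraicGeometry.Resolution.HauserPerlega2019
open PointBlowup (polarMap additiveSubspace direction)

variable {K : Type} [Field K]

/-! ## 1. The top coefficient of a sheared monomial -/

section ShearMonomial

variable [DecidableEq K]

/-- The top monomial occurs in `shear j b (x^r)` (it carries the maximal `x_j`-exponent `degreeOf j`).
[folklore] -/
theorem coeff_topMonomial_ne_zero (j : Fin 4) {b : Fin 4 → K} (hbj : b j = 0) (r : Fin 4 →₀ ℕ) :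
    coeff (topMonomial j b r) (shear j b (monomial r (1 : K))) ≠ 0 := by
  have hne : shear j b (monomial r (1 : K)) ≠ 0 :=
    shear_ne_zero j hbj (monomial_eq_zero.not.mpr one_ne_zero)
  obtain ⟨μ, hμ, heq⟩ := Finset.exists_mem_eq_sup _ (MvPolynomial.support_nonempty.mpr hne)
    (fun m : Fin 4 →₀ ℕ => m j)
  have hμj : μ j = ∑ i, r i * (if i = j ∨ b i ≠ 0 then 1 else 0) := by
    have hd := degreeOf_shear_monomial j hbj r (c := (1 : K)) one_ne_zero
    rw [degreeOf_eq_sup] at hd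
    rw [← hd, heq]
  have hμeq : μ = topMonomial j b r := eq_topMonomial_of_apply_eq j hbj r hμ hμj
  subst hμeq
  exact MvPolynomial.mem_support_iff.mp hμ

/-- **Product coefficients at the top**: for an `x_j`-free `Q` and an `x_j`-free exponent `ν`,
`coeff_{top + ν} (shear(x^r) · Q) = coeff_top (shear x^r) · coeff_ν Q`. [folklore] -/
theorem coeff_topMonomial_add_mul (j : Fin 4) {b : Fin 4 → K} (hbj : b j = 0) (r : Fin 4 →₀ ℕ)
    {Q : MvPolynomial (Fin 4) K} (hQ : ∀ e ∈ Q.support, e j = 0) {ν : Fin 4 →₀ ℕ} (hν : ν j = 0) :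
    coeff (topMonomial j b r + ν) (shear j b (monomial r (1 : K)) * Q) =
      coeff (topMonomial j b r) (shear j b (monomial r (1 : K))) * coeff ν Q := by
  rw [coeff_mul, Finset.sum_eq_single (topMonomial j b r, ν)]
  · rintro ⟨μ, ν'⟩ hmem hne
    rw [Finset.HasAntidiagonal.mem_antidiagonal] at hmem
    by_cases hμ : μ ∈ (shear j b (monomial r (1 : K))).support
    · by_cases hν' : ν' ∈ Q.support
      · exfalso
        have hj : μ j = ∑ i, r i * (if i = j ∨ b i ≠ 0 then 1 else 0) := by
          have h1 := congrArg (fun f : Fin 4 →₀ ℕ => f j) hmem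
          simp only [Finsupp.coe_add, Pi.add_apply, hQ ν' hν', hν, add_zero, topMonomial_apply,
            if_true] at h1
          exact h1
        have hμeq : μ = topMonomial j b r := eq_topMonomial_of_apply_eq j hbj r hμ hj
        rw [hμeq] at hmem
        exact hne (Prod.ext hμeq (add_left_cancel hmem))
      · rw [MvPolynomial.notMem_support_iff.mp hν', mul_zero]
    · rw [MvPolynomial.notMem_support_iff.mp hμ, zero_mul]
  · intro h
    exfalso
    apply h
    rw [Finset.HasAntidiagonal.mem_antidiagonal]

end ShearMonomial

/-! ## 2. Shear bookkeeping: products, scalars, homogeneity, the degree-`o` layer -/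

/-- `shear` is multiplicative. [folklore] -/
theorem shear_mul (j : Fin 4) (t : Fin 4 → K) (P Q : MvPolynomial (Fin 4) K) :
    shear j t (P * Q) = shear j t P * shear j t Q := by
  unfold shear; exact map_mul _ _ _

/-- `shear` preserves homogeneity (it is a graded substitution). [folklore] -/
theorem isHomogeneous_shear (j : Fin 4) (t : Fin 4 → K) {Φ : MvPolynomial (Fin 4) K} {n : ℕ}
    (hΦ : Φ.IsHomogeneous n) : (shear j t Φ).IsHomogeneous n := by
  classical
  rw [Φ.as_sum]
  unfold shear
  rw [map_sum]
  refine MvPolynomial.IsHomogeneous.sum _ _ _ fun d hd => ?_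
  have hdeg : d.degree = n := by
    have := hΦ (MvPolynomial.mem_support_iff.mp hd)
    rwa [weight_one_eq_degree] at this
  rw [← hdeg]
  exact Straightening.isHomogeneous_shear_monomial j t d _

/-- In degree `ord₀ F` the sheared polynomial and the sheared initial form have the same coefficients
(the higher part of `F` shears into degrees `> ord₀ F`). [folklore] -/
theorem coeff_shear_eq_coeff_shear_initialForm_of_degree_eq (j : Fin 4) (t : Fin 4 → K)
    {F : MvPolynomial (Fin 4) K} {o : ℕ} (ho : ordZero F = o) {e : Fin 4 →₀ ℕ} (hdeg : e.degree = o) :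
    coeff e (shear j t F) = coeff e (shear j t (initialForm F)) := by
  classical
  have hsplit : shear j t F = shear j t (initialForm F) + shear j t (F - initialForm F) := by
    unfold shear; rw [← map_add, add_sub_cancel]
  rw [hsplit, coeff_add, add_eq_left]
  have hord : ((o + 1 : ℕ) : ℕ∞) ≤ ordAlong Finset.univ (F - initialForm F) := by
    refine le_ordAlong_of_forall fun d hd => ?_
    rw [degIn_univ]
    exact lt_degree_of_mem_support_sub_initialForm ho hd
  have hord' := Straightening.le_ordAlong_univ_shear j t hord
  by_contra hne
  have h := le_degree_of_mem_support hord' (MvPolynomial.mem_support_iff.mpr hne)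
  omega

/-- `|r| ≤ ord₀ F` when `x^r ∣ F ≠ 0`. [folklore] -/
theorem degree_r_le {s : State K} {o : ℕ} (ho : ordZero s.F = o) (hr : ∀ d ∈ s.F.support, s.r ≤ d) :
    s.r.degree ≤ o := by
  obtain ⟨⟨d₀, hd₀, hd₀deg⟩, -⟩ := (ordZero_eq_nat_iff _ _).mp ho
  exact hd₀deg ▸ PointBlowup.degree_le_degree_of_le (hr d₀ (MvPolynomial.mem_support_iff.mpr hd₀))

/-- Polars commute with scalars in the form: `D_w (c • Q) = c • D_w Q`. [folklore] -/
theorem polarMap_smul_form (c : K) (Q : MvPolynomial (Fin 4) K) (w : Fin 4 → K) :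
    polarMap (c • Q) w = c • polarMap Q w := by
  rw [NarrowApolarity.polarMap_apply, NarrowApolarity.polarMap_apply, Finset.smul_sum]
  refine Finset.sum_congr rfl fun i _ => ?_
  rw [Derivation.map_smul, smul_comm]

/-- Moh-permissibility of the point centre is automatic: `|r| + (o − |r|) ≤ |d|` on the support.
[folklore] -/
theorem perm_univ {s : State K} {o : ℕ} (ho : ordZero s.F = o) (hr : ∀ d ∈ s.F.support, s.r ≤ d) :
    ∀ d ∈ s.F.support, degIn Finset.univ s.r + (o - s.r.degree) ≤ degIn Finset.univ d := by
  intro d hd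
  rw [degIn_univ, degIn_univ]
  have h := Literature.Barriers.ResolutionOfSingularities.ordZero_le_of_coeff_ne_zero _ _
    (MvPolynomial.mem_support_iff.mp hd)
  rw [ho] at h
  have h1 : o ≤ d.degree := by exact_mod_cast h
  have h2 : s.r.degree ≤ d.degree := PointBlowup.degree_le_degree_of_le (hr d hd)
  omega

/-! ## 3. The point step in the band: new boundary, new order, the `x_j`-free layer -/

section Step

variable [DecidableEq K]

/-- **The new boundary of a point step**: `r′ = (r|_{b = 0}).update j (o − q)`. [folklore] -/
theorem step_r_univ (q : ℕ) (j : Fin 4) {b : Fin 4 → K} (hbj : b j = 0) (s : State K) {o : ℕ}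
    (ho : ordZero s.F = o) (hr : ∀ d ∈ s.F.support, s.r ≤ d) :
    (CentreBlowup.step q Finset.univ j b s).r = (s.r.filter (fun i => b i = 0)).update j (o - q) := by
  have h := step_r_eq q Finset.univ j b hbj s ho hr (perm_univ ho hr)
  rw [degIn_univ, PointBlowup.filter_update_of_pos s.r (Z := fun i => b i = 0) hbj] at h
  rw [h]
  have hro := degree_r_le ho hr
  congr 1
  omega

/-- At a shade-keeping step the new polynomial is non-zero. [folklore] -/
theorem step_F_ne_zero_of_shade_eq {q : ℕ} (j : Fin 4) (b : Fin 4 → K) {s : State K} {o : ℕ}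
    (ho : ordZero s.F = o) (heq : (CentreBlowup.step q Finset.univ j b s).shade = s.shade) :
    (CentreBlowup.step q Finset.univ j b s).F ≠ 0 := by
  intro h0
  have h := heq
  rw [BandShade.shade_eq_coe ho] at h
  unfold CState.shade at h
  rw [h0, ordZero_zero, ENat.top_sub_coe] at h
  exact ENat.top_ne_coe _ h

/-- **The new order at a shade-keeping band step**: `ord₀ F′ = |r′| + (o − |r|)`. [folklore] -/
theorem ordZero_step_of_shade_eq {q : ℕ} (j : Fin 4) {b : Fin 4 → K} (hbj : b j = 0) {s : State K}
    {o : ℕ} (ho : ordZero s.F = o) (hr : ∀ d ∈ s.F.support, s.r ≤ d)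
    (heq : (CentreBlowup.step q Finset.univ j b s).shade = s.shade) :
    ordZero (CentreBlowup.step q Finset.univ j b s).F =
      (((CentreBlowup.step q Finset.univ j b s).r.degree + (o - s.r.degree) : ℕ) : ℕ∞) := by
  have hF'ne := step_F_ne_zero_of_shade_eq j b ho heq
  have hne : ordZero (CentreBlowup.step q Finset.univ j b s).F ≠ ⊤ := by
    unfold ordZero
    rw [Ne, MvPowerSeries.order_eq_top_iff, MvPolynomial.coe_eq_zero_iff]
    exact hF'ne
  obtain ⟨o', ho'⟩ := WithTop.ne_top_iff_exists.mp hne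
  have ho'' : ordZero (CentreBlowup.step q Finset.univ j b s).F = o' := ho'.symm
  have hr'le : (CentreBlowup.step q Finset.univ j b s).r.degree ≤ o' := by
    obtain ⟨⟨d₀, hd₀, hd₀deg⟩, -⟩ := (ordZero_eq_nat_iff _ _).mp ho''
    exact hd₀deg ▸ PointBlowup.degree_le_degree_of_le
      (newMult_le_of_mem_support_step q Finset.univ j b hbj s ho hr (perm_univ ho hr) d₀
        (MvPolynomial.mem_support_iff.mpr hd₀))
  have h := heq
  rw [BandShade.shade_eq_coe ho'', BandShade.shade_eq_coe ho] at h
  have h' : o' - (CentreBlowup.step q Finset.univ j b s).r.degree = o - s.r.degree := by exact_mod_cast h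
  rw [ho'']
  congr 1
  omega

/-- **THE `x_j`-FREE LAYER OF THE NEW RESIDUAL CONE** ((VT)(ii), layer `0`): at a point step in the band
(`x^r ∣ F`, `q < ord₀ F = o < 2q`, `b_j = 0`) that KEEPS the shade, for every `x_j`-free exponent `ν`,
`coeff_ν (resForm s′) = c · coeff_ν (shear j b (resForm s))` with `c = coeff_top (shear j b x^r)` (`≠ 0` by
`coeff_topMonomial_ne_zero`).  Frame form of [CJS 2020] Thm. 3.10(4) with Thm. 9.3 (the `u`-free part of
the transform of the cone is the cone in the translated coordinates); here for the POLAR-KERNEL bookkeeping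
only. [OURS] [cite: CossartJannsenSaito2020, Thm. 3.10(4), Thm. 9.3] -/
theorem coeff_resForm_step_of_apply_eq_zero {q : ℕ} (j : Fin 4) {b : Fin 4 → K} (hbj : b j = 0)
    {s : State K} {o : ℕ} (ho : ordZero s.F = o) (hr : ∀ d ∈ s.F.support, s.r ≤ d) (hqo : q < o)
    (ho2 : o < 2 * q) (heq : (CentreBlowup.step q Finset.univ j b s).shade = s.shade) {ν : Fin 4 →₀ ℕ}
    (hν : ν j = 0) :
    coeff ν (resForm (CentreBlowup.step q Finset.univ j b s)) =
      coeff (topMonomial j b s.r) (shear j b (monomial s.r (1 : K))) *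
        coeff ν (shear j b (resForm s)) := by
  have hq : (q : ℕ∞) ≤ ordAlong Finset.univ s.F := by
    rw [ordAlong_univ, ho]; exact_mod_cast hqo.le
  have hq' := Straightening.le_ordAlong_univ_shear j b hq
  have hro := degree_r_le ho hr
  have hfree := shear_resForm_free_of_shade_eq j hbj ho hr hqo ho2 heq
  have hr' := step_r_univ q j hbj s ho hr
  have ho' := ordZero_step_of_shade_eq j hbj ho hr heq
  have hhom : (shear j b (resForm s)).IsHomogeneous (o - s.r.degree) :=
    isHomogeneous_shear j b (resForm_isHomogeneous ho)
  rw [coeff_resForm]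
  unfold initialForm
  rw [ho', ENat.toNat_coe, coeff_homogeneousComponent]
  by_cases hνdeg : ν.degree = o - s.r.degree
  · -- the honest layer: `|r′ + ν| = ord₀ F′`
    have hdeg' : ((CentreBlowup.step q Finset.univ j b s).r + ν).degree =
        (CentreBlowup.step q Finset.univ j b s).r.degree + (o - s.r.degree) := by
      rw [map_add, hνdeg]
    rw [if_pos hdeg']
    -- the source exponent `e = top + ν` of degree `o` and its chart image `r′ + ν`
    have hedeg : (topMonomial j b s.r + ν).degree = o := by
      rw [map_add, degree_topMonomial, hνdeg]; omega
    have hE : chartExponent q Finset.univ j (topMonomial j b s.r + ν) =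
        (CentreBlowup.step q Finset.univ j b s).r + ν := by
      ext i
      by_cases hij : i = j
      · rw [hij, chartExponent_univ_apply_self, hedeg, Finsupp.add_apply, hν, add_zero, hr',
          Finsupp.update_apply, if_pos rfl]
      · rw [chartExponent_apply_of_ne q Finset.univ hij, Finsupp.add_apply, Finsupp.add_apply, hr',
          Finsupp.update_apply, if_neg hij, topMonomial_apply, if_neg hij, Finsupp.filter_apply]
    have hnp : ¬ IsPthPowerExponent q ((CentreBlowup.step q Finset.univ j b s).r + ν) := by
      intro hP
      have hj' : ((CentreBlowup.step q Finset.univ j b s).r + ν) j = o - q := by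
        rw [Finsupp.add_apply, hr', Finsupp.update_apply, if_pos rfl, hν, add_zero]
      have hdvd : q ∣ ((CentreBlowup.step q Finset.univ j b s).r + ν) j :=
        hP j (Finsupp.mem_support_iff.mpr (by rw [hj']; omega))
      rw [hj'] at hdvd
      have := Nat.le_of_dvd (by omega) hdvd
      omega
    rw [step_F_eq_deletePthPowers_chartTransform_shear q j hbj s hq, coeff_deletePthPowers, if_neg hnp,
      ← hE, coeff_chartTransform_chartExponent' hq' (by rw [hedeg]; exact hqo.le),
      coeff_shear_eq_coeff_shear_initialForm_of_degree_eq j b ho hedeg, ← monomial_mul_resForm hr,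
      shear_mul, coeff_topMonomial_add_mul j hbj s.r hfree hν]
  · -- off the layer both sides vanish
    have hdeg' : ((CentreBlowup.step q Finset.univ j b s).r + ν).degree ≠
        (CentreBlowup.step q Finset.univ j b s).r.degree + (o - s.r.degree) := by
      rw [map_add]; omega
    rw [if_neg hdeg']
    have hzero : coeff ν (shear j b (resForm s)) = 0 := by
      by_contra hne
      have := hhom hne
      rw [weight_one_eq_degree] at this
      exact hνdeg this
    rw [hzero, mul_zero]

/-- **The `x_j`-free part of the new residual cone** at a shade-keeping band step:
`(resForm s′)|_{x_j = 0} = c • shear j b (resForm s)`, `c = coeff_top (shear j b x^r) ≠ 0`.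
[OURS] [cite: CossartJannsenSaito2020, Thm. 3.10(4), Thm. 9.3] -/
theorem killVar_resForm_step {q : ℕ} (j : Fin 4) {b : Fin 4 → K} (hbj : b j = 0) {s : State K} {o : ℕ}
    (ho : ordZero s.F = o) (hr : ∀ d ∈ s.F.support, s.r ≤ d) (hqo : q < o) (ho2 : o < 2 * q)
    (heq : (CentreBlowup.step q Finset.univ j b s).shade = s.shade) :
    PointBlowup.killVar j (resForm (CentreBlowup.step q Finset.univ j b s)) =
      coeff (topMonomial j b s.r) (shear j b (monomial s.r (1 : K))) • shear j b (resForm s) := by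
  have hfree := shear_resForm_free_of_shade_eq j hbj ho hr hqo ho2 heq
  ext γ
  rw [coeff_killVar, coeff_smul, smul_eq_mul]
  split_ifs with hγ
  · exact coeff_resForm_step_of_apply_eq_zero j hbj ho hr hqo ho2 heq hγ
  · rw [MvPolynomial.notMem_support_iff.mp fun hm => hγ (hfree γ hm), mul_zero]

/-- **TRANSPORT OF THE NEW POLAR KERNEL OFF `e_j`** (the injection behind (VT)(iii)): at a shade-keeping
band step, a vector `w` with `w_j = 0` in the polar kernel of the new residual cone lies in the polar
kernel of the SHEARED old cone: `resVertex s′ ∩ {w_j = 0} ⊆ additiveSubspace (shear j b (resForm s))`.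
[OURS] [cite: CossartJannsenSaito2020, Thm. 3.10(4), Thm. 9.3] -/
theorem mem_additiveSubspace_shear_of_mem_resVertex_step {q : ℕ} (j : Fin 4) {b : Fin 4 → K}
    (hbj : b j = 0) {s : State K} {o : ℕ} (ho : ordZero s.F = o) (hr : ∀ d ∈ s.F.support, s.r ≤ d)
    (hqo : q < o) (ho2 : o < 2 * q) (heq : (CentreBlowup.step q Finset.univ j b s).shade = s.shade)
    {w : Fin 4 → K} (hw : w ∈ resVertex (CentreBlowup.step q Finset.univ j b s)) (hwj : w j = 0) :
    w ∈ additiveSubspace (shear j b (resForm s)) := by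
  unfold resVertex at hw
  unfold additiveSubspace at hw ⊢
  rw [LinearMap.mem_ker] at hw ⊢
  have h := congrArg (PointBlowup.killVar j) hw
  rw [map_zero, ← polarMap_killVar _ hwj, killVar_resForm_step j hbj ho hr hqo ho2 heq,
    polarMap_smul_form, smul_eq_zero] at h
  exact h.resolve_left (coeff_topMonomial_ne_zero j hbj s.r)

/-- **(VT)(iii), set form**: `resVertex s′ ⊓ hyperplane j ≤ additiveSubspace (shear j b (resForm s))`.
[OURS] [cite: CossartJannsenSaito2020, Thm. 3.10(4), Thm. 9.3] -/
theorem resVertex_step_inf_hyperplane_le {q : ℕ} (j : Fin 4) {b : Fin 4 → K} (hbj : b j = 0)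
    {s : State K} {o : ℕ} (ho : ordZero s.F = o) (hr : ∀ d ∈ s.F.support, s.r ≤ d) (hqo : q < o)
    (ho2 : o < 2 * q) (heq : (CentreBlowup.step q Finset.univ j b s).shade = s.shade) :
    resVertex (CentreBlowup.step q Finset.univ j b s) ⊓ hyperplane j ≤
      additiveSubspace (shear j b (resForm s)) := by
  intro w hw
  rw [Submodule.mem_inf, mem_hyperplane] at hw
  exact mem_additiveSubspace_shear_of_mem_resVertex_step j hbj ho hr hqo ho2 heq hw.1 hw.2

end Step

end ResCone

end Summit.ResolutionOfSingularities.ResolutionOfSingularities.Theorems.PIDim4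

end
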